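import Summits.CriticalPhenomena.PercolationContinuityZ3.Theorems.FreeBoxPowerSaving.Negative.FreeBoxPowerSavingBounds
import Literature.Probability.Percolation.RSW
import Literature.Probability.LatticeModels.ThermodynamicLimit
import HarnessLib

/-!
# Crux `PercNonProliferation.FreeBoxPowerSaving` (stmt-CriticalPhenomena-4447), line `Sketch`
# (card `l2-gluing-defect-rg`) — stub `stub_contractionImpliesCrux`

Helper file for the crux skeleton `Cruxes/FreeBoxPowerSaving/Lines/Sketch.lean`
(lead prover-line-stmt-CriticalPhenomena-4447-a1-0).  Proves exactly the registered stub signature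
`stub_contractionImpliesCrux` (the card's A1: "an eventual uniform contraction per tripling of the
box at `p_c` is already a power saving"); lands with `--supports stmt-CriticalPhenomena-4447`.

## The statement

Bond percolation `P_p` on `ℤ³`, free box `B(n) = box 3 n = [-n,n]³` (`|B(n)| = (2n+1)³`),
`S_p(n) = Σ_{x,y ∈ B(n)} P_p(x ↔ y inside B(n))` (`FreeBoxPowerSavingNegative.pairSum`) and
`FA₂(p,n) = S_p(n) / |B(n)|²` (`FreeBoxPowerSavingNegative.fa2`).  The stub: if for some `ρ < 1`
and all large `n`, `FA₂(p_c, 3n+1) ≤ ρ · FA₂(p_c, n)`, then the crux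
`∃ a C, 0 < a ∧ ∀ n ≥ 1, FA₂(p_c, n) ≤ C n^{-a}` holds.  We prove the implication at EVERY
parameter `p` (`ContractionImpliesCrux.powerSaving_of_contraction`); `p = p_c` is only
substituted at the end.

## The argument

0. `FA₂ ≥ 0`, so the hypothesis survives replacing `ρ` by `ρ' = max ρ (1/2) ∈ (0,1)`
   (this also disposes of `ρ ≤ 0`, where the hypothesis is in fact unsatisfiable since `FA₂ > 0`).
1. MONOTONICITY: `S_p` is monotone in `n` (`B(m) ⊆ B(n)`, `{x ↔ y in B(m)} ⊆ {x ↔ y in B(n)}`, more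
   non-negative terms), and `|B(3m+1)|² = 729 |B(m)|²` (`2(3m+1)+1 = 3(2m+1)`).  Hence for
   `m ≤ n ≤ 3m+1`: `FA₂(n) ≤ S(3m+1)/|B(m)|² = 729 FA₂(3m+1)`.
2. ITERATION along `N₀ = max n₀ 1`, `N_{k+1} = 3 N_k + 1` (so `2 N_k + 1 = 3^k (2 N₀ + 1)`):
   `FA₂(N_k) ≤ ρ'^k FA₂(N₀) ≤ ρ'^k`.
3. INTERPOLATION: every `n ≥ N₀` has `N_k ≤ n < N_{k+1}` for some `k`, whence
   `FA₂(n) ≤ 729 FA₂(N_{k+1}) ≤ 729 ρ'^{k+1}`.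
4. EXPONENT: `a = -log₃ ρ' > 0`, `ρ' = 3^{-a}`, and `n < N_{k+1} ≤ 3^{k+1} (2N₀+1)` gives
   `ρ'^{k+1} = (3^{k+1})^{-a} ≤ (2N₀+1)^a n^{-a}`.  So `FA₂(n) ≤ 729 (2N₀+1)^a · n^{-a}` for all
   `n ≥ N₀`, and `FreeBoxPowerSavingNegative.of_eventually` upgrades this to all `n ≥ 1`.

Mathlib API: `Real.logb_neg`, `Real.rpow_logb`, `Real.rpow_pow_comm`, `Real.rpow_le_rpow_of_nonpos`,
`Real.mul_rpow`, `Real.rpow_add`, `div_le_div₀`, `Nat.le_induction`, `Function.iterate_succ_apply'`.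
Tree API: `pairSum`, `fa2`, `freeBoxPowerSaving_iff_fa2`, `pairSum_nonneg`, `card_box_pos`,
`card_box_real`, `fa2_nonneg`, `fa2_le_one`, `of_eventually` (`FreeBoxPowerSavingNegative`),
`openConnIn_mono` (RSW), `box_mono` (ThermodynamicLimit).
-/

noncomputable section

open MeasureTheory Filter
open Literature.Probability.Percolation Literature.Probability.LatticeModels
open scoped BigOperators Topology

namespace Summit.CriticalPhenomena.PercolationContinuityZ3.FreeBoxPowerSavingLine

open Summit.CriticalPhenomena.PercolationContinuityZ3.FreeBoxPowerSavingNegative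

namespace ContractionImpliesCrux

/-! ### Step 1: monotonicity of the pair sum and the `729` sandwich -/

/-- **The free-box pair sum is monotone in the box**: `S_p(m) ≤ S_p(n)` for `m ≤ n`
(`B(m) ⊆ B(n)`, `{x ↔ y in B(m)} ⊆ {x ↔ y in B(n)}`, and the extra terms are non-negative). -/
theorem pairSum_mono (p : unitInterval) {m n : ℕ} (h : m ≤ n) : pairSum p m ≤ pairSum p n := by
  have hsub : box 3 m ⊆ box 3 n := box_mono 3 h
  have hsub' : (↑(box 3 m) : Set (Site 3)) ⊆ ↑(box 3 n) := Finset.coe_subset.2 hsub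
  unfold pairSum
  calc ∑ x ∈ box 3 m, ∑ y ∈ box 3 m,
        (bondPercolation (zdGraph 3) p).real (openConnIn (↑(box 3 m) : Set (Site 3)) x y)
      ≤ ∑ x ∈ box 3 m, ∑ y ∈ box 3 m,
          (bondPercolation (zdGraph 3) p).real (openConnIn (↑(box 3 n) : Set (Site 3)) x y) :=
        Finset.sum_le_sum fun x _ => Finset.sum_le_sum fun y _ =>
          measureReal_mono (openConnIn_mono hsub' x y)
    _ ≤ ∑ x ∈ box 3 n, ∑ y ∈ box 3 m,
          (bondPercolation (zdGraph 3) p).real (openConnIn (↑(box 3 n) : Set (Site 3)) x y) :=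
        Finset.sum_le_sum_of_subset_of_nonneg hsub fun _ _ _ =>
          Finset.sum_nonneg fun _ _ => measureReal_nonneg
    _ ≤ ∑ x ∈ box 3 n, ∑ y ∈ box 3 n,
          (bondPercolation (zdGraph 3) p).real (openConnIn (↑(box 3 n) : Set (Site 3)) x y) :=
        Finset.sum_le_sum fun x _ =>
          Finset.sum_le_sum_of_subset_of_nonneg hsub fun _ _ _ => measureReal_nonneg

/-- `|B(m)|² ≤ |B(n)|²` for `m ≤ n`. -/
theorem card_sq_mono {m n : ℕ} (h : m ≤ n) :
    ((box 3 m).card : ℝ) ^ 2 ≤ ((box 3 n).card : ℝ) ^ 2 := by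
  have h1 : (box 3 m).card ≤ (box 3 n).card := Finset.card_le_card (box_mono 3 h)
  have h2 : ((box 3 m).card : ℝ) ≤ ((box 3 n).card : ℝ) := by exact_mod_cast h1
  exact pow_le_pow_left₀ (Nat.cast_nonneg _) h2 2

/-- `|B(3m+1)|² = 729 |B(m)|²` (`2(3m+1)+1 = 3(2m+1)`). -/
theorem card_sq_tripling (m : ℕ) :
    ((box 3 (3 * m + 1)).card : ℝ) ^ 2 = 729 * ((box 3 m).card : ℝ) ^ 2 := by
  rw [card_box_real, card_box_real]; push_cast; ring

/-- **The `729` sandwich**: for `m ≤ n ≤ 3m+1`, `FA₂(p,n) ≤ S(3m+1)/|B(m)|² = 729 · FA₂(p,3m+1)`. -/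
theorem fa2_le_of_bracket (p : unitInterval) {m n : ℕ} (h1 : m ≤ n) (h2 : n ≤ 3 * m + 1) :
    fa2 p n ≤ 729 * fa2 p (3 * m + 1) := by
  have hc : (0 : ℝ) < ((box 3 m).card : ℝ) ^ 2 := pow_pos (card_box_pos m) 2
  unfold fa2
  rw [card_sq_tripling m]
  calc pairSum p n / ((box 3 n).card : ℝ) ^ 2
      ≤ pairSum p (3 * m + 1) / ((box 3 m).card : ℝ) ^ 2 :=
        div_le_div₀ (pairSum_nonneg p _) (pairSum_mono p h2) hc (card_sq_mono h1)
    _ = 729 * (pairSum p (3 * m + 1) / (729 * ((box 3 m).card : ℝ) ^ 2)) := by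
        field_simp

/-! ### Step 2: the tripling sequence `N_{k+1} = 3 N_k + 1` -/

/-- A tripling sequence started anywhere exists (an iterate of `m ↦ 3m+1`). -/
theorem exists_seq (n₁ : ℕ) : ∃ N : ℕ → ℕ, N 0 = n₁ ∧ ∀ k, N (k + 1) = 3 * N k + 1 :=
  ⟨fun k => (fun m => 3 * m + 1)^[k] n₁, rfl, fun k => Function.iterate_succ_apply' _ k n₁⟩

/-- A tripling sequence dominates its start: `N₀ ≤ N_k`. -/
theorem seq_zero_le {N : ℕ → ℕ} (hN : ∀ k, N (k + 1) = 3 * N k + 1) (k : ℕ) : N 0 ≤ N k := by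
  induction k with
  | zero => exact le_rfl
  | succ k ih => rw [hN]; omega

/-- Closed form of a tripling sequence: `2 N_k + 1 = 3^k (2 N₀ + 1)`. -/
theorem seq_closed {N : ℕ → ℕ} (hN : ∀ k, N (k + 1) = 3 * N k + 1) (k : ℕ) :
    2 * N k + 1 = 3 ^ k * (2 * N 0 + 1) := by
  induction k with
  | zero => simp
  | succ k ih =>
    calc 2 * N (k + 1) + 1 = 3 * (2 * N k + 1) := by rw [hN]; ring
      _ = 3 ^ (k + 1) * (2 * N 0 + 1) := by rw [ih]; ring

/-- Every `n ≥ N₀` is bracketed by two consecutive terms of a tripling sequence. -/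
theorem exists_bracket {N : ℕ → ℕ} (hN : ∀ k, N (k + 1) = 3 * N k + 1) {n : ℕ} (hn : N 0 ≤ n) :
    ∃ k, N k ≤ n ∧ n < N (k + 1) := by
  induction n, hn using Nat.le_induction with
  | base => exact ⟨0, le_rfl, by rw [hN]; omega⟩
  | succ n _ ih =>
    obtain ⟨k, hk1, hk2⟩ := ih
    by_cases h : n + 1 < N (k + 1)
    · exact ⟨k, hk1.trans (Nat.le_succ n), h⟩
    · have heq : N (k + 1) = n + 1 := by omega
      exact ⟨k + 1, heq.le, by rw [hN (k + 1)]; omega⟩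

/-- **Iteration of the contraction**: if `FA₂(p, 3n+1) ≤ ρ FA₂(p, n)` for `n ≥ n₀` (`ρ ≥ 0`) and
`N` is a tripling sequence with `N₀ ≥ n₀`, then `FA₂(p, N_k) ≤ ρ^k` (using `FA₂ ≤ 1` at `k = 0`). -/
theorem fa2_seq_le (p : unitInterval) {ρ : ℝ} (hρ : 0 ≤ ρ) {n₀ : ℕ} {N : ℕ → ℕ} (hN0 : n₀ ≤ N 0)
    (hN : ∀ k, N (k + 1) = 3 * N k + 1)
    (h : ∀ n : ℕ, n₀ ≤ n → fa2 p (3 * n + 1) ≤ ρ * fa2 p n) (k : ℕ) : fa2 p (N k) ≤ ρ ^ k := by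
  induction k with
  | zero => rw [pow_zero]; exact fa2_le_one p _
  | succ k ih =>
    rw [hN, pow_succ]
    calc fa2 p (3 * N k + 1) ≤ ρ * fa2 p (N k) := h _ (hN0.trans (seq_zero_le hN k))
      _ ≤ ρ * ρ ^ k := mul_le_mul_of_nonneg_left ih hρ
      _ = ρ ^ k * ρ := mul_comm _ _

/-! ### Step 3: the exponent -/

/-- **Geometric decay in `k` is a power of `n`**: if `3^{-a} = ρ` (`a ≥ 0`), `M > 0`, `n > 0` and
`n ≤ 3^j M`, then `ρ^j = (3^j)^{-a} ≤ M^a · n^{-a}`. -/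
theorem rho_pow_le {ρ a : ℝ} (h3a : (3 : ℝ) ^ (-a) = ρ) (ha : 0 ≤ a) {M : ℝ} (hM : 0 < M)
    {n : ℕ} (hn : 0 < n) {j : ℕ} (hle : (n : ℝ) ≤ 3 ^ j * M) :
    ρ ^ j ≤ M ^ a * (n : ℝ) ^ (-a) := by
  have hn0 : (0 : ℝ) < n := by exact_mod_cast hn
  have hX : (0 : ℝ) < 3 ^ j := by positivity
  rw [← h3a, Real.rpow_pow_comm (by norm_num : (0 : ℝ) ≤ 3) (-a) j]
  have h1 : ((3 : ℝ) ^ j * M) ^ (-a) ≤ (n : ℝ) ^ (-a) :=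
    Real.rpow_le_rpow_of_nonpos hn0 hle (by linarith)
  rw [Real.mul_rpow hX.le hM.le] at h1
  have h2 : M ^ (-a) * M ^ a = 1 := by
    rw [← Real.rpow_add hM, neg_add_cancel, Real.rpow_zero]
  calc ((3 : ℝ) ^ j) ^ (-a) = ((3 : ℝ) ^ j) ^ (-a) * M ^ (-a) * M ^ a := by
        rw [mul_assoc, h2, mul_one]
    _ ≤ (n : ℝ) ^ (-a) * M ^ a := mul_le_mul_of_nonneg_right h1 (Real.rpow_nonneg hM.le a)
    _ = M ^ a * (n : ℝ) ^ (-a) := mul_comm _ _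

/-! ### Step 4: assembly at an arbitrary parameter -/

/-- **An eventual uniform contraction per tripling is a power saving (every `p`).**  If for some
`ρ < 1` and all `n ≥ n₀`, `FA₂(p, 3n+1) ≤ ρ FA₂(p, n)`, then `∃ a C, 0 < a ∧ ∀ n ≥ 1,
FA₂(p, n) ≤ C n^{-a}` (with `a = -log₃ max(ρ, 1/2)`). -/
theorem powerSaving_of_contraction (p : unitInterval) {ρ : ℝ} (hρ1 : ρ < 1) {n₀ : ℕ}
    (h : ∀ n : ℕ, n₀ ≤ n → fa2 p (3 * n + 1) ≤ ρ * fa2 p n) :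
    ∃ a C : ℝ, 0 < a ∧ ∀ n : ℕ, 1 ≤ n → fa2 p n ≤ C * (n : ℝ) ^ (-a) := by
  -- (0) WLOG `0 < ρ`: enlarge `ρ` to `ρ' = max ρ (1/2)`
  set ρ' : ℝ := max ρ (1 / 2) with hρ'
  have hρ'0 : 0 < ρ' := lt_max_of_lt_right one_half_pos
  have hρ'1 : ρ' < 1 := max_lt hρ1 one_half_lt_one
  have h' : ∀ n : ℕ, n₀ ≤ n → fa2 p (3 * n + 1) ≤ ρ' * fa2 p n := fun n hn =>
    (h n hn).trans (mul_le_mul_of_nonneg_right (le_max_left _ _) (fa2_nonneg p n))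
  -- (2) the tripling sequence from `N₀ = max n₀ 1`
  obtain ⟨N, hN0, hN⟩ := exists_seq (max n₀ 1)
  have hn₀N : n₀ ≤ N 0 := by rw [hN0]; exact le_max_left _ _
  have h1N : 1 ≤ N 0 := by rw [hN0]; exact le_max_right _ _
  -- (4) the exponent `a = -log₃ ρ'`, `3^{-a} = ρ'`
  set a : ℝ := -Real.logb 3 ρ' with ha_def
  have ha : 0 < a := neg_pos.2 (Real.logb_neg (by norm_num) hρ'0 hρ'1)
  have h3a : (3 : ℝ) ^ (-a) = ρ' := by
    rw [ha_def, neg_neg]; exact Real.rpow_logb (by norm_num) (by norm_num) hρ'0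
  have hM : (0 : ℝ) < 2 * (N 0 : ℝ) + 1 := by positivity
  -- the eventual bound for `n ≥ N₀`, then `of_eventually`
  have hev : ∀ᶠ n : ℕ in atTop, fa2 p n ≤ 729 * (2 * (N 0 : ℝ) + 1) ^ a * (n : ℝ) ^ (-a) := by
    rw [Filter.eventually_atTop]
    refine ⟨N 0, fun n hn => ?_⟩
    -- (3) interpolation: `N_k ≤ n < N_{k+1} = 3 N_k + 1`
    obtain ⟨k, hk1, hk2⟩ := exists_bracket hN hn
    have hn3 : n ≤ 3 * N k + 1 := by rw [← hN]; exact hk2.le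
    have hnpos : 0 < n := by omega
    have hle_nat : n ≤ 3 ^ (k + 1) * (2 * N 0 + 1) := by
      rw [← seq_closed hN (k + 1)]; omega
    have hle : (n : ℝ) ≤ 3 ^ (k + 1) * (2 * (N 0 : ℝ) + 1) := by exact_mod_cast hle_nat
    calc fa2 p n ≤ 729 * fa2 p (3 * N k + 1) := fa2_le_of_bracket p hk1 hn3
      _ = 729 * fa2 p (N (k + 1)) := by rw [hN]
      _ ≤ 729 * ρ' ^ (k + 1) := by
          gcongr
          exact fa2_seq_le p hρ'0.le hn₀N hN h' (k + 1)
      _ ≤ 729 * ((2 * (N 0 : ℝ) + 1) ^ a * (n : ℝ) ^ (-a)) := by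
          gcongr
          exact rho_pow_le h3a ha.le hM hnpos hle
      _ = 729 * (2 * (N 0 : ℝ) + 1) ^ a * (n : ℝ) ^ (-a) := by ring
  obtain ⟨C', hC'⟩ := of_eventually ha hev
  exact ⟨a, C', ha, hC'⟩

end ContractionImpliesCrux

open ContractionImpliesCrux

/-- **stub_contractionImpliesCrux (card A1: an eventual uniform contraction per tripling at `p_c`
is the crux).**  If for some `ρ < 1` and all large `n`,
`FA₂(p_c, 3n+1) ≤ ρ · FA₂(p_c, n)` (spelled out: `|B(3n+1)|⁻² Σ_{x,y ∈ B(3n+1)} P_{p_c}(x ↔ y in B(3n+1))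
≤ ρ · |B(n)|⁻² Σ_{x,y ∈ B(n)} P_{p_c}(x ↔ y in B(n))`), then `FreeBoxPowerSaving` holds:
`∃ a C, 0 < a ∧ ∀ n ≥ 1, FA₂(p_c, n) ≤ C n^{-a}`.  Proof: the hypothesis is definitionally
`∀ n ≥ n₀, fa2 p_c (3n+1) ≤ ρ · fa2 p_c n`; apply `powerSaving_of_contraction` (iterate along
`N_{k+1} = 3N_k + 1`, interpolate at cost `729` by box-monotonicity of the pair sum, `a = -log₃ ρ`)
and `freeBoxPowerSaving_iff_fa2`. [folklore] -/
theorem stub_contractionImpliesCrux :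
    (∃ ρ : ℝ, ρ < 1 ∧ ∃ n₀ : ℕ, ∀ n : ℕ, n₀ ≤ n →
      (∑ x ∈ box 3 (3 * n + 1), ∑ y ∈ box 3 (3 * n + 1),
          (bondPercolation (zdGraph 3) (criticalProbI 3)).real
            (openConnIn (↑(box 3 (3 * n + 1)) : Set (Site 3)) x y)) /
          ((box 3 (3 * n + 1)).card : ℝ) ^ 2 ≤
        ρ * ((∑ x ∈ box 3 n, ∑ y ∈ box 3 n,
          (bondPercolation (zdGraph 3) (criticalProbI 3)).real
            (openConnIn (↑(box 3 n) : Set (Site 3)) x y)) / ((box 3 n).card : ℝ) ^ 2)) →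
      Summit.CriticalPhenomena.PercolationContinuityZ3.Theses.PercNonProliferation.FreeBoxPowerSaving := by
  rintro ⟨ρ, hρ, n₀, h⟩
  exact freeBoxPowerSaving_iff_fa2.2 (powerSaving_of_contraction (criticalProbI 3) hρ h)

end Summit.CriticalPhenomena.PercolationContinuityZ3.FreeBoxPowerSavingLine

end
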